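import Literature.IUT.HodgeTheaters.PuncturedEllipticArrowModelTheta
import Literature.IUT.HodgeTheaters.PuncturedEllipticArrowModelModLCuspLaws
import HarnessLib

/-!
# NV: `ModLCuspLaws` at the Γ-LIFTED §1 model `pedOf Γ l` (inside `Γ × (N ⋊ D_l)`) and at `geometryOf`

[IUTchI] §1 pp. 37–38, Def. 3.1 (d) p. 62 [cite: Mochizuki2012, IUTchI §1 pp.37-38] (D-0012 claim key, status
disputed).  PROOF-ONLY companion of `PuncturedEllipticArrowModelModLCuspLaws.lean` (p448735: the six laws at the
`G_k = 1` datum) and of abc-iut-L5-t1 gen 3's lift `pedOf Γ l h5 h6` / `geometryOf GK l` (p430830 / p431229: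
the §1 model inside `Γ × (N ⋊ D_l)` over an arbitrary profinite `Γ = G_K`, and the `ThetaGeometry G_F G_K l`
built on it).  abc-iut-L5-lead RULINGS #72 (1) (JOINT-NV-CG stage B «build ON the ArrowModel»): at the datum
`(geometryOf GK l …).pe = pedOf GK l …` the binder set {CG, hA, hO, hL} is now jointly inhabited by name —
`liftCuspGalois`, `pedOf_arrowCoveringClaims`, `pedOf_arrowOpenClaims` (p431229) and `pedOf_modLCuspLaws` (here).
No `def`, no instance.

WHAT IS PROVED: `ArrowModel.pedOf_modLCuspLaws Γ l h5 h6 : (pedOf Γ l h5 h6).ModLCuspLaws` — transport of the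
six laws along `{1} × (·)` (`botSub`): `Δ_X̲ = {1} × N`, `I_x = {1} × D_x`, `Ker(Δ_X̲ ↠ Δ_ε) = {1} × EpsSup`,
`Ker(Δ_X̲ ↠ Δ_X̲^{ab} ⊗ ℤ/l) = 1`; `Π_X̲ = Γ × N` centralises `{1} × D_x` because `N` is abelian — and
`ArrowModel.geometryOf_pe_modLCuspLaws` (the same at the `ThetaGeometry`).

HONEST FRAMING: a semi-synthetic instance (genuine `Γ`, finite geometric part); nothing here asserts abc proved or
refuted or takes a side on [IUTchIII] Cor. 3.12; inhabited ≠ discharged at the genuine datum.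
-/

namespace Literature.IUT.HodgeTheaters

namespace PuncturedEllipticData

namespace ArrowModel

open Literature.AnabelianGeometry.AbsoluteAnabelian DihedralGroup
open scoped Pointwise

section LiftGroup

variable (Γ : Type) [Group Γ] (l : ℕ)

/-- `inr : Φ → Γ × Φ` is injective. [claim: Mochizuki2012, status: disputed] -/
theorem inr_injective : Function.Injective (MonoidHom.inr Γ (G l)) := fun _ _ h => (Prod.ext_iff.mp h).2

/-- `{1} × (D ∩ E) = ({1} × D) ∩ ({1} × E)`. [claim: Mochizuki2012, status: disputed] -/
theorem botSub_inf (D E : Subgroup (G l)) : botSub Γ l (D ⊓ E) = botSub Γ l D ⊓ botSub Γ l E :=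
  Subgroup.map_inf D E _ (inr_injective Γ l)

/-- (L0) lifted: `[{1} × N : 1] ≠ 0`. [claim: Mochizuki2012, status: disputed] -/
theorem relIndex_bot_botSub_Nhat_ne_zero [NeZero l] :
    (⊥ : Subgroup (Γ × G l)).relIndex (botSub Γ l (Nhat l)) ≠ 0 := by
  rw [← Subgroup.map_bot (MonoidHom.inr Γ (G l))]
  exact (botSub_relIndex Γ l ⊥ (Nhat l)).trans_ne relIndex_bot_Nhat_ne_zero

/-- (L1) lifted: `{1} × D_x = ⟨(1, ĉ_x)⟩`. [claim: Mochizuki2012, status: disputed] -/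
theorem botSub_Dm_eq (x : ZMod l) : botSub Γ l (Dm l x) = Subgroup.zpowers ((1 : Γ), chat l x) := by
  unfold botSub Dm; rw [MonoidHom.map_zpowers]; rfl

variable {Γ l}

/-- (L3) lifted: for `c ∈ {1} × (Π_C̲ ∖ N)`, `v ∈ {1} × N`: `c v c⁻¹ v ∈ {1} × (D_1 · D_{−1} · EpsSup)`.
[claim: Mochizuki2012, status: disputed] -/
theorem lift_conj_mul_self_mem (h5 : 5 ≤ l) {c v : Γ × G l} (hc : c ∈ botSub Γ l (PiCbarm l))
    (hcX : c ∉ botSub Γ l (Nhat l)) (hv : v ∈ botSub Γ l (Nhat l)) :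
    c * v * c⁻¹ * v ∈ botSub Γ l (Dm l 1 ⊔ Dm l (-1) ⊔ EpsSup l) := by
  obtain ⟨hc1, hc2⟩ := mem_botSub.mp hc
  obtain ⟨hv1, hv2⟩ := mem_botSub.mp hv
  have hcX2 : c.2 ∉ Nhat l := fun h => hcX (mem_botSub.mpr ⟨hc1, h⟩)
  refine mem_botSub.mpr ⟨?_, ?_⟩
  · simp only [Prod.fst_mul, Prod.fst_inv, hc1, hv1, mul_one, inv_one]
  · simp only [Prod.snd_mul, Prod.snd_inv]
    exact conj_mul_self_mem_sup h5 hc2 hcX2 hv2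

/-- (L4) lifted: `Γ × N` centralises `{1} × D_x`. [claim: Mochizuki2012, status: disputed] -/
theorem lift_conj_mul_inv_eq_one {g z : Γ × G l} (hg : g ∈ liftSub Γ l (Nhat l)) {x : ZMod l}
    (hz : z ∈ botSub Γ l (Dm l x)) : g * z * g⁻¹ * z⁻¹ = 1 := by
  obtain ⟨hz1, hz2⟩ := mem_botSub.mp hz
  have hg2 : g.2 ∈ Nhat l := mem_liftSub.mp hg
  refine Prod.ext ?_ ?_
  · simp only [Prod.fst_mul, Prod.fst_inv, hz1, mul_one, inv_one, mul_inv_cancel, Prod.fst_one]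
  · simp only [Prod.snd_mul, Prod.snd_inv, Prod.snd_one]
    exact conj_mul_inv_eq_one hg2 hz2

end LiftGroup

section Lift

variable (Γ : Type) [Group Γ] [TopologicalSpace Γ] [IsTopologicalGroup Γ] [CompactSpace Γ]
  [TotallyDisconnectedSpace Γ] (l : ℕ) [NeZero l] (h5 : 5 ≤ l) (h6 : Nat.Coprime l 6)

/-- **NV: `ModLCuspLaws` at the Γ-lifted §1 model `pedOf Γ l`** (all six laws, every profinite `Γ`, every
admissible `l`). ([IUTchI] §1 pp.37–38) [claim: Mochizuki2012, status: disputed] -/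
theorem pedOf_modLCuspLaws : (pedOf Γ l h5 h6).ModLCuspLaws := by
  have h3 : 3 ≤ l := by omega
  refine ⟨?_, ?_, ?_, ?_, ?_, ?_⟩
  · -- (L0) `modLKer = 1`, `Δ_X̲ = {1} × N` finite
    rw [pedOf_modLKer, pedOf_deltaXbar]
    exact relIndex_bot_botSub_Nhat_ne_zero Γ l
  · -- (L1) `I_x = {1} × ⟨ĉ_x⟩ = ⟨(1, ĉ_x)⟩`
    intro x
    refine ⟨((1 : Γ), chat l x), by rw [pedOf_inertia]; exact mem_botSub.mpr ⟨rfl, chat_mem_Dm x⟩, ?_⟩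
    rw [pedOf_inertia]
    intro y hy
    rw [botSub_Dm_eq] at hy
    exact Subgroup.le_topologicalClosure _ hy
  · -- (L2a)
    rw [pedOf_deltaEpsKer, pedOf_inertia]
    show (botSub Γ l (EpsSup l)).relIndex (botSub Γ l (Dm l 1) ⊔ botSub Γ l (EpsSup l) : Subgroup (Γ × G l)) = l
    rw [← botSub_sup, botSub_relIndex]
    exact relIndex_EpsSup_Dm_one_sup h3
  · -- (L2c)
    rw [pedOf_inertia, pedOf_inertia, pedOf_deltaEpsKer]
    show (botSub Γ l (Dm l 1) ⊓ (botSub Γ l (Dm l (-1)) ⊔ botSub Γ l (EpsSup l)) : Subgroup (Γ × G l)) ≤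
      botSub Γ l (EpsSup l)
    rw [← botSub_sup, ← botSub_inf]
    exact botSub_mono Γ l (Dm_one_inf_sup_le h5)
  · -- (L3)
    intro c hc hcX v hv
    rw [pedOf_deltaCbar] at hc
    rw [pedOf_deltaXbar] at hcX hv
    rw [pedOf_inertia, pedOf_inertia, pedOf_deltaEpsKer]
    show c * v * c⁻¹ * v ∈ (botSub Γ l (Dm l 1) ⊔ botSub Γ l (Dm l (-1)) ⊔ botSub Γ l (EpsSup l) :
      Subgroup (Γ × G l))
    rw [← botSub_sup, ← botSub_sup]
    exact lift_conj_mul_self_mem h5 hc hcX hv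
  · -- (L4) `Π_X̲ = Γ × N` centralises `{1} × D_x` (`N` abelian)
    intro x g hg z hz
    rw [pedOf_piXbar] at hg
    rw [pedOf_inertia] at hz
    rw [pedOf_modLKer, Subgroup.mem_bot]
    exact lift_conj_mul_inv_eq_one hg hz

/-- A geometric `ι̲` at the lifted model: `(1, σ) ∈ Δ_C̲ ∖ Δ_X̲`. [claim: Mochizuki2012, status: disputed] -/
theorem pedOf_exists_iota : ∃ c ∈ (pedOf Γ l h5 h6).DeltaCbar, c ∉ (pedOf Γ l h5 h6).DeltaXbar := by
  refine ⟨((1 : Γ), sigmaHat l), ?_, ?_⟩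
  · rw [pedOf_deltaCbar]; exact mem_botSub.mpr ⟨rfl, sigmaHat_mem_PiCbarm l⟩
  · rw [pedOf_deltaXbar]; exact fun h => sigmaHat_not_mem_Nhat l (mem_botSub.mp h).2

end Lift

section Theta

variable {GF : Type} [Group GF] [TopologicalSpace GF] [IsTopologicalGroup GF] [CompactSpace GF]
  [TotallyDisconnectedSpace GF] (GK : Subgroup GF) (l : ℕ) [NeZero l]

/-- **At the `ThetaGeometry` `geometryOf G_K l`**: the `Δ_ε`-level laws hold for its `K`-level datum
`pe = pedOf G_K l` — so {CuspGalois (`liftCuspGalois`), `ArrowCoveringClaims`, `ArrowOpenClaims`, `ModLCuspLaws`}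
are JOINTLY inhabited at one `ThetaGeometry` over any profinite `G_F ⊇ G_K` (closed).
([IUTchI] Def 3.1 (d) p.62, §1 p.38) [claim: Mochizuki2012, status: disputed] -/
theorem geometryOf_pe_modLCuspLaws (hGK : IsClosed (GK : Set GF)) (h5 : 5 ≤ l) (h6 : l.Coprime 6) :
    (geometryOf GK l hGK h5 h6).pe.ModLCuspLaws := by
  letI : CompactSpace GK := isCompact_iff_compactSpace.mp hGK.isCompact
  exact pedOf_modLCuspLaws GK l h5 h6

end Theta

end ArrowModel

end PuncturedEllipticData

end Literature.IUT.HodgeTheaters
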